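import Summits.Ventures.CertifiedManyBodySolver.Observables.PairLROTowerCeilingAuxReading
import Summits.Ventures.CertifiedManyBodySolver.Observables.RungLeavesPairAnchor
import HarnessLib

/-!
# The sharp one-point ceiling WITH AUXILIARY CHORD ROWS — consumer: the anchor-generic summit-format leaf
# `ObsPairLROCeilingAt` (node shape with Hamiltonian-difference rows)

HONEST FRAMING: first certified bounds on pairing observables; not a superconductivity verdict. Cell hubbard-algo
(D-0042 crew (5)), seat hubbard-box-eng-3 (`prover-hubbard-box-eng-3-g6-0`), on hubbard-obs-p1 g14's design
(PAIRCORR-SDP §21.7; obs RULING (hq) d261 (hq2) item «BOX1-A0T-CHORD»). Zero compute; no definition; no named fact;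
no `sorry`. A CEILING at positivity scale never speaks to presence; no phase sentence.

`PairLROTowerCeilingAux.liminf_pairFieldLRO_le_sq_of_onePoint_variational_bound_TT'_aux` (hubbard-obs-p1 g14) reads a
one-point variational bound with AUXILIARY HAMILTONIAN-DIFFERENCE rows
`Σ_j ρ_j (w_j − Re⟨ζ,(H_L(θ) − H_L(θ_j))ζ⟩/(δ_j L²))`, valid for every unit `ζ` of every large torus, together with the
CHORD premises `e(θ; n) − e(θ_j; n) ≤ δ_j w_j`, as the Koma–Tasaki ceiling `liminf_k u_k ≤ (c − A + (Σμ)(n/2 − ν))²`;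
its right-hand side is the pair field `−Re⟨ζ, Δ_g ζ⟩/L²`. The OP1-E claim nodes of the tree state their row with the
space-group-averaged ORBIT STATE on the right (`Re ω̄_ζ(Γ(ι_L)(−Γ(incl)Φ₀^g))`), exactly as the consumers of
`PairLROTowerCeilingCert` / `RungLeavesPairAnchor` §5. The orbit-state form of the aux discharger,
`liminf_pairFieldLRO_le_sq_of_onePoint_orbitState_bound_TT'_aux`, is hubbard-obs-p1 g14's
(`PairLROTowerCeilingAuxReading`, p547535 — the first edition of THIS file, p547518, declared a byte-identical twin of it
in the same minute; this edition imports p1's and drops the twin so the name is declared ONCE in the tree). This file adds: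
* `ObsPairLROCeilingAt_of_onePoint_orbitState_bound_sq_aux` — the anchor-generic summit-format leaf
  `ObsPairLROCeilingAt tp U n c'` (`t = 1`, d-wave form factor, `b1gSign = 1` on the point group) at every
  rational `c' ≥ (c − A + (Σμ)(n/2 − ν))²`, for a node-shape bound WITH auxiliary Hamiltonian-difference rows
  (the consumer of `Certificates/HubbardSquare_n7o8_obsOP1E_TLB0gbD2_box1chord_A0`'s ray transport).
References: T. Koma, H. Tasaki, J. Stat. Phys. 76 (1994) 745, Theorem 5 [KomaTasaki1994]; O. Bratteli,
D. W. Robinson, *Operator Algebras and Quantum Statistical Mechanics 2* (1997) §6.2.4 [BratteliRobinsonII1997];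
D. J. Scalapino, Phys. Rep. 250 (1995) 329, §2 eq. (2.4) [Scalapino1995].
-/

noncomputable section

namespace Summit.Ventures.CertifiedManyBodySolver.Observables

open Matrix Complex Finset Literature.MathematicalPhysics.QuantumLattice Literature.Probability.LatticeModels
open Literature.MathematicalPhysics.QuantumLattice.HubbardWave0 ThermodynamicLimit Filter Topology
open Literature.MathematicalPhysics.QuantumManyBody.StateRelaxation
open Summit.Ventures.CertifiedManyBodySolver.Transport
open scoped ComplexOrder ComplexConjugate BigOperators

/-- **OP1-E orbit-state node WITH AUXILIARY CHORD ROWS at `(U, n, t′)` ⇒ the summit-format leaf at the sharp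
(Koma–Tasaki tower) constant.** Point group `S ≠ ∅` with `b1gSign = 1` on `S`, window
`Λ' ⊇ pairRegion {0,±e₁,±e₂} 0` fitting the tori of side `≥ L₁`; `κ ≥ 0`; cap `e(1,tp,U;n) ≤ u`; auxiliary
points `θ_j = (1, tpa_j, Ua_j)` (`Ua_j ≥ 0`) with `ρ_j ≥ 0`, `δ_j > 0` and the CHORD premises
`e(1,tp,U;n) − e(1,tpa_j,Ua_j;n) ≤ δ_j w_j`; the node inequality with the auxiliary Hamiltonian-difference rows for
every unit `ζ`; `0 ≤ U`, `0 < n < 2`. Then `ObsPairLROCeilingAt tp U n c'` for every rational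
`c' ≥ (c − A + (Σμ)(n/2 − ν))²`. A ceiling; says nothing about presence. [cite: KomaTasaki1994, Theorem 5]
[cite: Scalapino1995, §2 eq. (2.4)] -/
theorem ObsPairLROCeilingAt_of_onePoint_orbitState_bound_sq_aux {tp U n : ℝ} {c' : ℚ} {c A κ u ν : ℝ}
    (hU : 0 ≤ U) (hn0 : 0 < n) (hn2 : n < 2) (μ : Fin 2 → ℝ) (hκ : 0 ≤ κ)
    (hu : energyDensityTT' 1 tp U n ≤ u)
    {ι : Type*} [Fintype ι] (tpa Ua δ ρ w : ι → ℝ) (hUa : ∀ j, 0 ≤ Ua j) (hδ : ∀ j, 0 < δ j)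
    (hρ : ∀ j, 0 ≤ ρ j)
    (hw : ∀ j, energyDensityTT' 1 tp U n - energyDensityTT' 1 (tpa j) (Ua j) n ≤ δ j * w j)
    {S : Finset (DihedralGroup 4)} (hS : S.Nonempty) (hS1 : ∀ γ ∈ S, b1gSign γ = 1)
    {Λ' : Finset (Site 2)} (h0 : pairRegion (insert (0 : Site 2) unitSteps) 0 ⊆ Λ') (L₁ : ℕ)
    (hInj : ∀ L : ℕ, L₁ ≤ L → Set.InjOn (Torus.proj (d := 2) L) ↑Λ')
    (hbound : ∀ (L : ℕ) [NeZero L] (hL : L₁ ≤ L) (ζ : Fock (Orb (FermionTorus 2 L))), star ζ ⬝ᵥ ζ = 1 →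
      c - A + ∑ σ : Fin 2, μ σ *
          ((star ζ ⬝ᵥ ((∑ y : FermionTorus 2 L, numberOp y σ) *ᵥ ζ)).re / (L : ℝ) ^ 2 - ν) +
        κ * (u - (star ζ ⬝ᵥ (hubbardTorusTT' L 1 tp U *ᵥ ζ)).re / (L : ℝ) ^ 2) +
        ∑ j, ρ j * (w j -
          (star ζ ⬝ᵥ ((hubbardTorusTT' L 1 tp U - hubbardTorusTT' L 1 (tpa j) (Ua j)) *ᵥ ζ)).re /
            (δ j * (L : ℝ) ^ 2)) ≤
        (orbitState (spaceGroupUnitary S) ζ (fermionEmbed (PolySite.toTorusEmb L (hInj L hL))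
          (-(fermionEmbed (PolySite.incl h0)
            (localPairAt (insert (0 : Site 2) unitSteps) dWaveFormFactor 0))))).re)
    (hc' : (c - A + (∑ σ : Fin 2, μ σ) * (n / 2 - ν)) ^ 2 ≤ ((c' : ℚ) : ℝ)) :
    ObsPairLROCeilingAt tp U n c' := by
  intro ψ hψ hψ1
  have hg : ∀ γ ∈ S, ∀ e ∈ insert (0 : Site 2) unitSteps, dWaveFormFactor (d4Vec γ e) = dWaveFormFactor e :=
    fun γ hγ e _ => dWaveFormFactor_d4Vec_of_b1gSign_eq_one (hS1 γ hγ) e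
  exact (liminf_pairFieldLRO_le_sq_of_onePoint_orbitState_bound_TT'_aux dWaveFormFactor 1 tp hU hn0 hn2 μ hκ
    hu (fun _ => 1) tpa Ua δ ρ w hUa hδ hρ hw hS hg h0 L₁ hInj hbound ψ hψ hψ1).trans hc'

end Summit.Ventures.CertifiedManyBodySolver.Observables

end
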